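import Summits.NavierStokesRegularity.NavierStokesRegularity.Theorems.WakeRatchetExtractionFrames

/-!
# WakeRatchetExtractionFrameLip — LINE g9-1 «clocked frames», part 3/7: ⟨22744⟩ `WakeRatchet.MinimalBlowupExtraction`

Ideator ns-idea-1 g9, LINE g9-1 «clocked frames» (critic of record idea-crit-3): part 3 of 7 of the split landing kit of
`extraction_proved.lean` (sha16 849d037365163546, the sorry-free proof of route item ⟨stmt-NavierStokesRegularity-22744⟩
`WakeRatchet.MinimalBlowupExtraction`), cut at the author's seams with every declaration VERBATIM; parts chain by import
(1 Ascoli → 2 Frames → 3 FrameLip → 4 Action → 5 Law → 6 Clock → 7 MinimalBlowupExtraction).  MODEL lattice only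
(Tao 2016 averaged Navier–Stokes cascade); no summit is proved by a line — part 7 closes ONE crux (K2) of route WakeRatchet.

This part: (E1b) the frames are eventually equi-Lipschitz on half-lines (`norm_frameDeriv_le`, `stubFrameLip_holds`) and (E3a)
the exact renormalised law of each clocked frame (`frame_law`).
-/

noncomputable section

set_option linter.dupNamespace false

namespace Summit.NavierStokesRegularity.NavierStokesRegularity.Cruxes.MinimalBlowupExtraction.ClockedFrames

open Set Filter Topology MeasureTheory
open scoped RealInnerProductSpace
open Literature.Analysis.FluidPDE Literature.Analysis.FluidPDE.TaoCascade
open Summit.NavierStokesRegularity.NavierStokesRegularity.Cruxes.MinimalBlowupExtraction.Extraction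
  (exists_subseq_continuousLimit_param)
open Summit.NavierStokesRegularity.NavierStokesRegularity.Theorems.DSSOneShift
  (hasDerivWithinAt_shellVec bigLam_zpow_eq_rpow)
open Summit.NavierStokesRegularity.NavierStokesRegularity.Theorems.WakeRatchetCritical
  (tableQ_smul tableA_smul tableB_smul_smul continuous_tableB)
open Summit.NavierStokesRegularity.NavierStokesRegularity.Theorems.TransitMassLedgerEnergy
  (continuous_tableQ continuous_tableA continuous_tableB_comp)
open Summit.NavierStokesRegularity.NavierStokesRegularity.Cruxes.MinimalBlowupExtraction.TableCont

variable {ε₀ : ℝ} {α : Fin 4 → Fin 4 → Fin 4 → ℤ × ℤ × ℤ → ℝ} {X₀ : Fin 4 → ℝ} {ν T C c : ℝ}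
  {X : Fin 4 → ℤ → ℝ → ℝ} {c' κ₁ κ₂ : ℝ} {τ : ℕ → ℝ}

/-- **The derivative bound of a clocked frame** on `[a, ∞)` once its window has opened (`e^{-a}(T − τ_j) < T`):
every term of the renormalised law is a product of type-I–bounded quantities. -/
theorem norm_frameDeriv_le (hP : Pinned ε₀ α X₀ ν T C c X) (hε : 0 < ε₀)
    (hclk : ClockedFiring ε₀ T c' κ₁ κ₂ X τ) (j : ℕ) (n : ℤ) {a u : ℝ} (hu : a ≤ u)
    (hwin : Real.exp (-a) * (T - τ j) < T) :
    ‖(bigLam ε₀ ^ (n + (j : ℤ)) * Real.exp (-(u + -Real.log (T - τ j)))) •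
          (Real.exp (-(u + -Real.log (T - τ j))) •
            dvec ε₀ α ν X (n + (j : ℤ)) (T - Real.exp (-(u + -Real.log (T - τ j))))) +
        (bigLam ε₀ ^ (n + (j : ℤ)) * -Real.exp (-(u + -Real.log (T - τ j)))) •
          shellVec X (n + (j : ℤ)) (T - Real.exp (-(u + -Real.log (T - τ j))))‖ ≤
      lipK α ν C ε₀ κ₂ n a := by
  obtain ⟨hν, hT, hc, hcd, hX0, hneg, hlaw, htypeI, hint, hpin, hfire⟩ := hP
  have hb : (0 : ℝ) < 1 + ε₀ := by linarith
  have hΛ : 0 < bigLam ε₀ := bigLam_pos (by linarith)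
  have gj : 0 < T - τ j := by linarith [(hclk j).2.1]
  obtain ⟨-, -, -, hup, -⟩ := hclk j
  -- the window
  rw [exp_shift gj]
  set E := Real.exp (-u) * (T - τ j) with hEdef
  have hE0 : 0 < E := mul_pos (Real.exp_pos _) gj
  have hEa : E ≤ Real.exp (-a) * (T - τ j) :=
    mul_le_mul_of_nonneg_right (Real.exp_le_exp.2 (by linarith)) gj.le
  have hET : E < T := lt_of_le_of_lt hEa hwin
  set k : ℤ := n + (j : ℤ) with hkdef
  set t : ℝ := T - E with htdef
  have ht0 : 0 ≤ t := by rw [htdef]; linarith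
  have htT : t < T := by rw [htdef]; linarith
  have hTt : T - t = E := by rw [htdef]; ring
  set L := bigLam ε₀ ^ k with hLdef
  have hL0 : 0 < L := zpow_pos hΛ k
  have hL1 : bigLam ε₀ ^ (k + 1) = L * bigLam ε₀ := zpow_add_one₀ hΛ.ne' k
  have hL2 : L = bigLam ε₀ ^ (k - 1) * bigLam ε₀ := by
    rw [hLdef, ← zpow_add_one₀ hΛ.ne', sub_add_cancel]
  -- type-I products
  have P0 : L * E * ‖shellVec X k t‖ ≤ C := by
    have h := htypeI k t ht0 htT; rwa [hTt] at h
  have Pp : bigLam ε₀ ^ (k + 1) * E * ‖shellVec X (k + 1) t‖ ≤ C := by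
    have h := htypeI (k + 1) t ht0 htT; rwa [hTt] at h
  have Pm : bigLam ε₀ ^ (k - 1) * E * ‖shellVec X (k - 1) t‖ ≤ C := by
    have h := htypeI (k - 1) t ht0 htT; rwa [hTt] at h
  have hC : 0 ≤ C := le_trans (by positivity) P0
  have hLm0 : 0 < bigLam ε₀ ^ (k - 1) := zpow_pos hΛ _
  have P0n : 0 ≤ L * E * ‖shellVec X k t‖ := by positivity
  have Ppn : 0 ≤ bigLam ε₀ ^ (k + 1) * E * ‖shellVec X (k + 1) t‖ := by
    rw [hL1]; positivity
  have Pmn : 0 ≤ bigLam ε₀ ^ (k - 1) * E * ‖shellVec X (k - 1) t‖ := by positivity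
  -- the velocity
  have hq := norm_qvec_le (α := α) (X := X) hε k t
  have hw2 : 0 < (1 + ε₀) ^ ((2 : ℝ) * k) := Real.rpow_pos_of_pos hb _
  have hd : ‖dvec ε₀ α ν X k t‖ ≤
      L * (shiftConst α (0, 0, 0) * ‖shellVec X k t‖ ^ 2 +
        (shiftConst α (1, 0, 0) + shiftConst α (0, 1, 0)) * ‖shellVec X (k + 1) t‖ * ‖shellVec X k t‖) +
      bigLam ε₀ ^ (k - 1) * (shiftConst α (0, 0, 1) * ‖shellVec X (k - 1) t‖ ^ 2) +
      ν * (1 + ε₀) ^ ((2 : ℝ) * k) * ‖shellVec X k t‖ := by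
    unfold dvec
    calc ‖shellVec (fun i k s => quadTerm ε₀ α X i k s) k t - (ν * (1 + ε₀) ^ ((2 : ℝ) * k)) • shellVec X k t‖
        ≤ ‖shellVec (fun i k s => quadTerm ε₀ α X i k s) k t‖ + ‖(ν * (1 + ε₀) ^ ((2 : ℝ) * k)) • shellVec X k t‖ :=
          norm_sub_le _ _
      _ = ‖shellVec (fun i k s => quadTerm ε₀ α X i k s) k t‖ + ν * (1 + ε₀) ^ ((2 : ℝ) * k) * ‖shellVec X k t‖ := by
          rw [norm_smul, Real.norm_of_nonneg (by positivity)]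
      _ ≤ _ := by rw [hLdef]; linarith [hq]
  -- the viscous coefficient in frame coordinates
  have hvisc : (1 + ε₀) ^ ((2 : ℝ) * k) * E ≤ (1 + ε₀) ^ ((2 : ℝ) * n) * (Real.exp (-a) * κ₂) := by
    have e1 : (1 + ε₀) ^ ((2 : ℝ) * k) = (1 + ε₀) ^ ((2 : ℝ) * n) * (1 + ε₀) ^ (2 * j) := by
      rw [hkdef, show (2 : ℝ) * ((n + (j : ℤ) : ℤ) : ℝ) = (2 : ℝ) * n + ((2 * j : ℕ) : ℝ) by push_cast; ring,
        Real.rpow_add hb, Real.rpow_natCast]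
    rw [e1, hEdef, mul_assoc]
    refine mul_le_mul_of_nonneg_left ?_ (Real.rpow_pos_of_pos hb _).le
    have h1 : (1 + ε₀) ^ (2 * j) * (T - τ j) ≤ κ₂ := by
      rw [mul_comm, ← le_mul_inv_iff₀ (pow_pos hb _)]; exact hup
    have h2 : Real.exp (-u) ≤ Real.exp (-a) := Real.exp_le_exp.2 (by linarith)
    calc (1 + ε₀) ^ (2 * j) * (Real.exp (-u) * (T - τ j)) = Real.exp (-u) * ((1 + ε₀) ^ (2 * j) * (T - τ j)) := by
          ring
      _ ≤ Real.exp (-a) * κ₂ := mul_le_mul h2 h1 (by positivity) (Real.exp_pos _).le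
  -- the four bounds
  have sQ0 := shiftConst_nonneg α (0, 0, 0)
  have sB0 : 0 ≤ shiftConst α (1, 0, 0) + shiftConst α (0, 1, 0) :=
    add_nonneg (shiftConst_nonneg α _) (shiftConst_nonneg α _)
  have sA0 := shiftConst_nonneg α (0, 0, 1)
  have B1 : L * E ^ 2 * (L * (shiftConst α (0, 0, 0) * ‖shellVec X k t‖ ^ 2)) ≤ shiftConst α (0, 0, 0) * C ^ 2 := by
    have e : L * E ^ 2 * (L * (shiftConst α (0, 0, 0) * ‖shellVec X k t‖ ^ 2)) =
        shiftConst α (0, 0, 0) * (L * E * ‖shellVec X k t‖) ^ 2 := by ring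
    rw [e]
    exact mul_le_mul_of_nonneg_left (pow_le_pow_left₀ P0n P0 2) sQ0
  have B2 : L * E ^ 2 * (L * ((shiftConst α (1, 0, 0) + shiftConst α (0, 1, 0)) * ‖shellVec X (k + 1) t‖ *
      ‖shellVec X k t‖)) ≤ (shiftConst α (1, 0, 0) + shiftConst α (0, 1, 0)) * C ^ 2 * (bigLam ε₀)⁻¹ := by
    have e : L * E ^ 2 * (L * ((shiftConst α (1, 0, 0) + shiftConst α (0, 1, 0)) * ‖shellVec X (k + 1) t‖ *
        ‖shellVec X k t‖)) = (shiftConst α (1, 0, 0) + shiftConst α (0, 1, 0)) * (bigLam ε₀)⁻¹ *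
        ((bigLam ε₀ ^ (k + 1) * E * ‖shellVec X (k + 1) t‖) * (L * E * ‖shellVec X k t‖)) := by
      rw [hL1]; field_simp
    rw [e, show (shiftConst α (1, 0, 0) + shiftConst α (0, 1, 0)) * C ^ 2 * (bigLam ε₀)⁻¹ =
      (shiftConst α (1, 0, 0) + shiftConst α (0, 1, 0)) * (bigLam ε₀)⁻¹ * (C * C) by ring]
    exact mul_le_mul_of_nonneg_left (mul_le_mul Pp P0 P0n hC) (by positivity)
  have B3 : L * E ^ 2 * (bigLam ε₀ ^ (k - 1) * (shiftConst α (0, 0, 1) * ‖shellVec X (k - 1) t‖ ^ 2)) ≤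
      shiftConst α (0, 0, 1) * bigLam ε₀ * C ^ 2 := by
    have e : L * E ^ 2 * (bigLam ε₀ ^ (k - 1) * (shiftConst α (0, 0, 1) * ‖shellVec X (k - 1) t‖ ^ 2)) =
        shiftConst α (0, 0, 1) * bigLam ε₀ * (bigLam ε₀ ^ (k - 1) * E * ‖shellVec X (k - 1) t‖) ^ 2 := by
      rw [hL2]; ring
    rw [e]
    exact mul_le_mul_of_nonneg_left (pow_le_pow_left₀ Pmn Pm 2) (by positivity)
  have B4 : L * E ^ 2 * (ν * (1 + ε₀) ^ ((2 : ℝ) * k) * ‖shellVec X k t‖) ≤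
      ν * κ₂ * Real.exp (-a) * (1 + ε₀) ^ ((2 : ℝ) * n) * C := by
    have e : L * E ^ 2 * (ν * (1 + ε₀) ^ ((2 : ℝ) * k) * ‖shellVec X k t‖) =
        ν * (((1 + ε₀) ^ ((2 : ℝ) * k) * E) * (L * E * ‖shellVec X k t‖)) := by ring
    rw [e, show ν * κ₂ * Real.exp (-a) * (1 + ε₀) ^ ((2 : ℝ) * n) * C =
      ν * (((1 + ε₀) ^ ((2 : ℝ) * n) * (Real.exp (-a) * κ₂)) * C) by ring]
    have hκ₂ : 0 < κ₂ :=
      (mul_pos_iff_of_pos_right (inv_pos.2 (pow_pos hb (2 * j)))).1 (lt_of_lt_of_le gj hup)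
    exact mul_le_mul_of_nonneg_left (mul_le_mul hvisc P0 P0n (by positivity)) hν.le
  -- assemble
  have hsm1 : ‖(L * E) • (E • dvec ε₀ α ν X k t)‖ = L * E ^ 2 * ‖dvec ε₀ α ν X k t‖ := by
    rw [norm_smul, norm_smul, Real.norm_of_nonneg (by positivity), Real.norm_of_nonneg hE0.le]; ring
  have hsm2 : ‖(L * -E) • shellVec X k t‖ = L * E * ‖shellVec X k t‖ := by
    rw [norm_smul, show L * -E = -(L * E) by ring, norm_neg, Real.norm_of_nonneg (by positivity)]
  have hfirst : L * E ^ 2 * ‖dvec ε₀ α ν X k t‖ ≤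
      shiftConst α (0, 0, 0) * C ^ 2 + (shiftConst α (1, 0, 0) + shiftConst α (0, 1, 0)) * C ^ 2 * (bigLam ε₀)⁻¹ +
        shiftConst α (0, 0, 1) * bigLam ε₀ * C ^ 2 + ν * κ₂ * Real.exp (-a) * (1 + ε₀) ^ ((2 : ℝ) * n) * C := by
    have h := mul_le_mul_of_nonneg_left hd (show 0 ≤ L * E ^ 2 by positivity)
    have e : L * E ^ 2 * (L * (shiftConst α (0, 0, 0) * ‖shellVec X k t‖ ^ 2 +
        (shiftConst α (1, 0, 0) + shiftConst α (0, 1, 0)) * ‖shellVec X (k + 1) t‖ * ‖shellVec X k t‖) +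
        bigLam ε₀ ^ (k - 1) * (shiftConst α (0, 0, 1) * ‖shellVec X (k - 1) t‖ ^ 2) +
        ν * (1 + ε₀) ^ ((2 : ℝ) * k) * ‖shellVec X k t‖) =
        L * E ^ 2 * (L * (shiftConst α (0, 0, 0) * ‖shellVec X k t‖ ^ 2)) +
        L * E ^ 2 * (L * ((shiftConst α (1, 0, 0) + shiftConst α (0, 1, 0)) * ‖shellVec X (k + 1) t‖ *
          ‖shellVec X k t‖)) +
        L * E ^ 2 * (bigLam ε₀ ^ (k - 1) * (shiftConst α (0, 0, 1) * ‖shellVec X (k - 1) t‖ ^ 2)) +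
        L * E ^ 2 * (ν * (1 + ε₀) ^ ((2 : ℝ) * k) * ‖shellVec X k t‖) := by ring
    rw [e] at h
    linarith [B1, B2, B3, B4]
  calc ‖(L * E) • (E • dvec ε₀ α ν X k t) + (L * -E) • shellVec X k t‖
      ≤ ‖(L * E) • (E • dvec ε₀ α ν X k t)‖ + ‖(L * -E) • shellVec X k t‖ := norm_add_le _ _
    _ = L * E ^ 2 * ‖dvec ε₀ α ν X k t‖ + L * E * ‖shellVec X k t‖ := by rw [hsm1, hsm2]
    _ ≤ lipK α ν C ε₀ κ₂ n a := by unfold lipK; linarith [hfirst, P0]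

/-- **(E1b) PROVED.** -/
theorem stubFrameLip_holds : StubFrameLip := by
  intro ε₀ R α X₀ ν T C c X hε _hα hP c' κ₁ κ₂ τ _hκ₁ hclk n a
  have hT : 0 < T := hP.2.1
  obtain ⟨J, hJ⟩ := eventually_window hε hT hclk a
  refine ⟨lipK α ν C ε₀ κ₂ n a, J, fun j hj u v hu hv => ?_⟩
  have gj : 0 < T - τ j := by linarith [(hclk j).2.1]
  have hwin' : ∀ w : ℝ, a ≤ w → Real.exp (-(w + -Real.log (T - τ j))) < T := by
    intro w hw
    rw [exp_shift gj]
    have h1 : Real.exp (-w) ≤ Real.exp (-a) := Real.exp_le_exp.2 (by linarith)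
    have h2 := mul_le_mul_of_nonneg_right h1 gj.le
    linarith [hJ j hj]
  have h := Convex.norm_image_sub_le_of_norm_hasDerivWithin_le
    (f := fun w => frame ε₀ T X j (-Real.log (T - τ j)) n w) (s := Ici a) (x := v) (y := u)
    (fun w hw => (hasDerivAt_frame hP j n (-Real.log (T - τ j)) (hwin' w hw)).hasDerivWithinAt)
    (fun w hw => norm_frameDeriv_le hP hε hclk j n hw (hJ j hj)) (convex_Ici a) hv hu
  simpa only [Real.norm_eq_abs] using h

/-! ## (E3a) proved: each clocked frame solves the `IsEternalVisc`-law with parameter `viscParam j` on its window -/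

/-- **The frames are exact solutions of the renormalised viscous law.**  On its window (`e^{-u}(T − τ_j) < T`) the
frame centred at shell `j` satisfies, shell by shell, exactly the `IsEternalVisc.law` vector field with covariant
viscosity parameter `viscParam j = ν(1+ε₀)^{2j}(T − τ_j)`: damping `1`, `Q`, feed `Λ•A` from below, drain `Λ⁻¹•B`
from above, dissipation `viscParam j · (1+ε₀)^{2n} e^{-u}`.  (Input (a) of the closure step.) -/
theorem frame_law (hP : Pinned ε₀ α X₀ ν T C c X) (hε : 0 < ε₀) (hclk : ClockedFiring ε₀ T c' κ₁ κ₂ X τ)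
    (j : ℕ) (n : ℤ) {u : ℝ} (hwin : Real.exp (-u) * (T - τ j) < T) :
    HasDerivAt (fun v => frame ε₀ T X j (-Real.log (T - τ j)) n v)
      (-((1 : ℝ) • frame ε₀ T X j (-Real.log (T - τ j)) n u)
        + tableQ α (frame ε₀ T X j (-Real.log (T - τ j)) n u)
        + bigLam ε₀ • tableA α (frame ε₀ T X j (-Real.log (T - τ j)) (n - 1) u)
        + (bigLam ε₀)⁻¹ • tableB α (frame ε₀ T X j (-Real.log (T - τ j)) (n + 1) u)
            (frame ε₀ T X j (-Real.log (T - τ j)) n u)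
        - (viscParam ε₀ ν T τ j * ((1 + ε₀) ^ ((2 : ℝ) * n) * Real.exp (-u))) •
            frame ε₀ T X j (-Real.log (T - τ j)) n u) u := by
  have hb : (0 : ℝ) < 1 + ε₀ := by linarith
  have hΛ : 0 < bigLam ε₀ := bigLam_pos (by linarith)
  have gj : 0 < T - τ j := by linarith [(hclk j).2.1]
  have hwin' : Real.exp (-(u + -Real.log (T - τ j))) < T := by rw [exp_shift gj]; exact hwin
  refine (hasDerivAt_frame hP j n (-Real.log (T - τ j)) hwin').congr_deriv ?_
  simp only [frame, renorm]
  rw [exp_shift gj]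
  -- indices
  rw [show n - 1 + ((j : ℕ) : ℤ) = n + (j : ℤ) - 1 by ring, show n + 1 + ((j : ℕ) : ℤ) = n + (j : ℤ) + 1 by ring]
  -- the velocity through the dictionary
  have e1 : (1 + ε₀) ^ ((5 : ℝ) * ((n + (j : ℤ) : ℤ) : ℝ) / 2) = bigLam ε₀ ^ (n + (j : ℤ)) := by
    have h := bigLam_zpow_eq_rpow hb (n + (j : ℤ))
    exact h
  have e2 : (1 + ε₀) ^ ((5 : ℝ) * (((n + (j : ℤ) : ℤ) : ℝ) - 1) / 2) = bigLam ε₀ ^ (n + (j : ℤ) - 1) := by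
    have h := bigLam_zpow_eq_rpow hb (n + (j : ℤ) - 1)
    push_cast at h ⊢
    exact h
  unfold dvec
  rw [shellVec_quadTerm, e1, e2, tableQ_smul, tableA_smul, tableB_smul_smul]
  -- scalar relations
  have hL1 : bigLam ε₀ ^ (n + (j : ℤ) + 1) = bigLam ε₀ ^ (n + (j : ℤ) - 1) * bigLam ε₀ ^ 2 := by
    rw [← zpow_natCast (bigLam ε₀) 2, ← zpow_add₀ hΛ.ne']; congr 1; push_cast; ring
  have hL0 : bigLam ε₀ ^ (n + (j : ℤ)) = bigLam ε₀ ^ (n + (j : ℤ) - 1) * bigLam ε₀ := by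
    rw [← zpow_add_one₀ hΛ.ne', sub_add_cancel]
  have hr : (1 + ε₀) ^ ((2 : ℝ) * ((n + (j : ℤ) : ℤ) : ℝ)) = (1 + ε₀) ^ ((2 : ℝ) * n) * (1 + ε₀) ^ (2 * j) := by
    rw [show (2 : ℝ) * ((n + (j : ℤ) : ℤ) : ℝ) = (2 : ℝ) * n + ((2 * j : ℕ) : ℝ) by push_cast; ring,
      Real.rpow_add hb, Real.rpow_natCast]
  rw [hL1, hL0, hr]
  unfold viscParam
  set M := bigLam ε₀ ^ (n + (j : ℤ) - 1) with hM
  set E := Real.exp (-u) * (T - τ j) with hE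
  set P := (1 + ε₀) ^ ((2 : ℝ) * n) with hPdef
  set G := (1 + ε₀) ^ (2 * j) with hG
  ext i
  simp only [PiLp.add_apply, PiLp.sub_apply, PiLp.neg_apply, PiLp.smul_apply, smul_eq_mul]
  field_simp
  ring

/-! ## Closure inputs (c) (d) (e): pointwise bound, far-tail envelope and window action of the frames -/

end Summit.NavierStokesRegularity.NavierStokesRegularity.Cruxes.MinimalBlowupExtraction.ClockedFrames

end
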